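import Literature.NumberTheory.IwasawaTheory.ClassicalMuVanishesSplitCartanFiveDescentAbelian
import Literature.NumberTheory.IwasawaTheory.ClassicalMuVanishesDivisionFieldFive
import Literature.NumberTheory.SerreUniformity.SplitCartan
import Mathlib.GroupTheory.PGroup
import HarnessLib

set_option autoImplicit false

/-!
# `μ = 0` for `ℚ(E[5])_cyc` from a split-Cartan-normaliser mod-5 image WITHOUT Ferrero–Washington: the `C_s⁺(5)` bridge and the
# division-field basis form with the three abelian leaves `K′`, `Z = ℚ(ζ₅)`, `Q₂` displayed

Topic `NumberTheory/IwasawaTheory` (namespace = path).  THEOREM-ONLY file (no definition, no named fact, no `sorry`); prover seat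
`bsd-potss-k8t-c4` g24 (cell `bsd-potss`; supports stmt-BirchSwinnertonDyer-19982 / 19916, KT rows with split Cartan image at `5`:
283200dw1, 283200gf1, 434400l1; closes nothing).  Twins of `ClassicalMuVanishesSplitCartanFiveImage` (§1, the bridge from a faithful
`ρ : Gal(L/ℚ) ↪ M₂(𝔽₅)` with values in `C_s⁺(5)`) and of `ClassicalMuVanishesDivisionFieldFive.classicalMuVanishes_divisionField_of_
splitCartanBasis_five` (§2, basis form on `ℚ(E[5])`) with `ferreroWashington1979_classicalMuVanishes` REPLACED by `μ = 0` for the three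
abelian fixed fields `K′ = L^{⟨uv⁻¹, w⟩}` (the cyclic quartic `ℚ(ζ₂₀)⁺`-type field `⊇ ℚ(√5)`), `Z = L^{⟨uv⁻¹, u²w⟩}` (`= L^{ker det} =
ℚ(ζ₅)`) and `Q₂ = L^{⟨uv⁻¹, wu⟩}` (`= ℚ(√(5 d₁))`, `d₁ = disc L^{C_s(5)}`) — via
`classicalMuVanishes_of_isCyclotomic_of_splitCartan_kuroda_rat_abelian`; the redundant leaf `ℚ(x P₁) ⊆ ℚ(P₁)` of g11 is dropped.
§0 repeats g11's finite facts about the 32 matrices of `C_s⁺(5)` (private there) verbatim.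

References: [Serre1972, §2.2 (split Cartan subgroups and their normalisers)]; [Lemmermeyer1994, §1]; [Washington1997, §7.5, §13.1];
[MilneFT2022, Ch. 3].
-/

noncomputable section

open scoped NumberField

open Field IntermediateField Literature.NumberTheory.EllipticCurves Literature.NumberTheory.SerreUniformity

namespace Literature.NumberTheory.IwasawaTheory

/-! ### §0 Finite facts about `C_s⁺(5) ⊂ GL₂(𝔽₅)` (by `decide`) -/

section Matrices

/-- An element of `splitCartanNormalizer 5` is `(a 0; 0 d)` with `ad ≠ 0` or `(0 b; c 0)` with `bc ≠ 0`. [folklore] -/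
private theorem shape_of_mem_splitCartanNormalizer₅ {M : Matrix (Fin 2) (Fin 2) (ZMod 5)}
    (hM : M ∈ splitCartanNormalizer 5) :
    (∃ a d : ZMod 5, a * d ≠ 0 ∧ M = !![a, 0; 0, d]) ∨ (∃ b c : ZMod 5, b * c ≠ 0 ∧ M = !![0, b; c, 0]) := by
  obtain ⟨hdet, h | h⟩ := hM
  · refine Or.inl ⟨M 0 0, M 1 1, ?_, ?_⟩
    · simpa only [Matrix.det_fin_two, h.1, h.2, mul_zero, sub_zero] using hdet
    · exact Matrix.ext fun i j => by fin_cases i <;> fin_cases j <;> simp [h.1, h.2]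
  · refine Or.inr ⟨M 0 1, M 1 0, ?_, ?_⟩
    · have h' : -(M 0 1 * M 1 0) ≠ 0 := by
        simpa only [Matrix.det_fin_two, h.1, h.2, zero_mul, zero_sub] using hdet
      exact neg_ne_zero.mp h'
    · exact Matrix.ext fun i j => by fin_cases i <;> fin_cases j <;> simp [h.1, h.2]

/-- Commutators in `C_s⁺(5)` lie in `{1, D, D², D³}`, `D = diag(2, 3)`: diagonal–diagonal. [folklore] -/
private theorem dd_comm₅ : ∀ a d a' d' : ZMod 5,
    (!![a, 0; 0, d] : Matrix (Fin 2) (Fin 2) (ZMod 5)) * !![a', 0; 0, d'] = !![a', 0; 0, d'] * !![a, 0; 0, d] := by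
  decide

/-- Commutators in `C_s⁺(5)`: diagonal–antidiagonal. [folklore] -/
private theorem da_comm₅ : ∀ a d b c : ZMod 5, a * d ≠ 0 → b * c ≠ 0 →
    (!![a, 0; 0, d] : Matrix (Fin 2) (Fin 2) (ZMod 5)) * !![0, b; c, 0] = !![0, b; c, 0] * !![a, 0; 0, d] ∨
    (!![a, 0; 0, d] : Matrix (Fin 2) (Fin 2) (ZMod 5)) * !![0, b; c, 0] = !![2, 0; 0, 3] * (!![0, b; c, 0] * !![a, 0; 0, d]) ∨
    (!![a, 0; 0, d] : Matrix (Fin 2) (Fin 2) (ZMod 5)) * !![0, b; c, 0] =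
      !![2, 0; 0, 3] * !![2, 0; 0, 3] * (!![0, b; c, 0] * !![a, 0; 0, d]) ∨
    (!![a, 0; 0, d] : Matrix (Fin 2) (Fin 2) (ZMod 5)) * !![0, b; c, 0] =
      !![2, 0; 0, 3] * !![2, 0; 0, 3] * !![2, 0; 0, 3] * (!![0, b; c, 0] * !![a, 0; 0, d]) := by
  decide

/-- Commutators in `C_s⁺(5)`: antidiagonal–diagonal. [folklore] -/
private theorem ad_comm₅ : ∀ b c a d : ZMod 5, b * c ≠ 0 → a * d ≠ 0 →
    (!![0, b; c, 0] : Matrix (Fin 2) (Fin 2) (ZMod 5)) * !![a, 0; 0, d] = !![a, 0; 0, d] * !![0, b; c, 0] ∨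
    (!![0, b; c, 0] : Matrix (Fin 2) (Fin 2) (ZMod 5)) * !![a, 0; 0, d] = !![2, 0; 0, 3] * (!![a, 0; 0, d] * !![0, b; c, 0]) ∨
    (!![0, b; c, 0] : Matrix (Fin 2) (Fin 2) (ZMod 5)) * !![a, 0; 0, d] =
      !![2, 0; 0, 3] * !![2, 0; 0, 3] * (!![a, 0; 0, d] * !![0, b; c, 0]) ∨
    (!![0, b; c, 0] : Matrix (Fin 2) (Fin 2) (ZMod 5)) * !![a, 0; 0, d] =
      !![2, 0; 0, 3] * !![2, 0; 0, 3] * !![2, 0; 0, 3] * (!![a, 0; 0, d] * !![0, b; c, 0]) := by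
  decide

/-- Commutators in `C_s⁺(5)`: antidiagonal–antidiagonal. [folklore] -/
private theorem aa_comm₅ : ∀ b c b' c' : ZMod 5, b * c ≠ 0 → b' * c' ≠ 0 →
    (!![0, b; c, 0] : Matrix (Fin 2) (Fin 2) (ZMod 5)) * !![0, b'; c', 0] = !![0, b'; c', 0] * !![0, b; c, 0] ∨
    (!![0, b; c, 0] : Matrix (Fin 2) (Fin 2) (ZMod 5)) * !![0, b'; c', 0] = !![2, 0; 0, 3] * (!![0, b'; c', 0] * !![0, b; c, 0]) ∨
    (!![0, b; c, 0] : Matrix (Fin 2) (Fin 2) (ZMod 5)) * !![0, b'; c', 0] =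
      !![2, 0; 0, 3] * !![2, 0; 0, 3] * (!![0, b'; c', 0] * !![0, b; c, 0]) ∨
    (!![0, b; c, 0] : Matrix (Fin 2) (Fin 2) (ZMod 5)) * !![0, b'; c', 0] =
      !![2, 0; 0, 3] * !![2, 0; 0, 3] * !![2, 0; 0, 3] * (!![0, b'; c', 0] * !![0, b; c, 0]) := by
  decide

/-- `A C = D^k C A` for `A, C ∈ C_s⁺(5)`, `D = diag(2,3)`, some `k ≤ 3`. [folklore] -/
private theorem mul_eq_of_mem₅ {A C : Matrix (Fin 2) (Fin 2) (ZMod 5)} (hA : A ∈ splitCartanNormalizer 5)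
    (hC : C ∈ splitCartanNormalizer 5) :
    A * C = C * A ∨ A * C = !![2, 0; 0, 3] * (C * A) ∨ A * C = !![2, 0; 0, 3] * !![2, 0; 0, 3] * (C * A) ∨
      A * C = !![2, 0; 0, 3] * !![2, 0; 0, 3] * !![2, 0; 0, 3] * (C * A) := by
  rcases shape_of_mem_splitCartanNormalizer₅ hA with ⟨a, d, had, rfl⟩ | ⟨b, c, hbc, rfl⟩ <;>
    rcases shape_of_mem_splitCartanNormalizer₅ hC with ⟨a', d', had', rfl⟩ | ⟨b', c', hbc', rfl⟩
  · exact Or.inl (dd_comm₅ a d a' d')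
  · exact da_comm₅ a d b' c' had hbc'
  · exact ad_comm₅ b c a' d' hbc had'
  · exact aa_comm₅ b c b' c' hbc hbc'

/-- Every element of `C_s⁺(5)` has order dividing `8`: diagonal. [folklore] -/
private theorem d_pow_eight₅ : ∀ a d : ZMod 5, a * d ≠ 0 → (!![a, 0; 0, d] : Matrix (Fin 2) (Fin 2) (ZMod 5)) ^ 8 = 1 := by
  decide

/-- Every element of `C_s⁺(5)` has order dividing `8`: antidiagonal. [folklore] -/
private theorem a_pow_eight₅ : ∀ b c : ZMod 5, b * c ≠ 0 → (!![0, b; c, 0] : Matrix (Fin 2) (Fin 2) (ZMod 5)) ^ 8 = 1 := by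
  decide

/-- Every element of `C_s⁺(5)` has order dividing `8`. [folklore] -/
private theorem pow_eight_eq_one_of_mem₅ {A : Matrix (Fin 2) (Fin 2) (ZMod 5)} (hA : A ∈ splitCartanNormalizer 5) :
    A ^ 8 = 1 := by
  rcases shape_of_mem_splitCartanNormalizer₅ hA with ⟨a, d, had, rfl⟩ | ⟨b, c, hbc, rfl⟩
  exacts [d_pow_eight₅ a d had, a_pow_eight₅ b c hbc]

/-- The scalar `diag(2,2)` is central: diagonal shape. [folklore] -/
private theorem d_scalar_comm₅ : ∀ a d : ZMod 5,
    (!![a, 0; 0, d] : Matrix (Fin 2) (Fin 2) (ZMod 5)) * !![2, 0; 0, 2] = !![2, 0; 0, 2] * !![a, 0; 0, d] := by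
  decide

/-- The scalar `diag(2,2)` is central: antidiagonal shape. [folklore] -/
private theorem a_scalar_comm₅ : ∀ b c : ZMod 5,
    (!![0, b; c, 0] : Matrix (Fin 2) (Fin 2) (ZMod 5)) * !![2, 0; 0, 2] = !![2, 0; 0, 2] * !![0, b; c, 0] := by
  decide

/-- `diag(2,2)` commutes with every element of `C_s⁺(5)`. [folklore] -/
private theorem scalar_comm_of_mem₅ {A : Matrix (Fin 2) (Fin 2) (ZMod 5)} (hA : A ∈ splitCartanNormalizer 5) :
    A * !![2, 0; 0, 2] = !![2, 0; 0, 2] * A := by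
  rcases shape_of_mem_splitCartanNormalizer₅ hA with ⟨a, d, _, rfl⟩ | ⟨b, c, _, rfl⟩
  exacts [d_scalar_comm₅ a d, a_scalar_comm₅ b c]

/-- Conjugating `diag(4,1)` by an element of `C_s⁺(5)` gives `diag(4,1)` or `diag(1,4)`: diagonal shape. [folklore] -/
private theorem d_conj_sq₅ : ∀ a d : ZMod 5,
    ((!![a, 0; 0, d] : Matrix (Fin 2) (Fin 2) (ZMod 5)) * !![4, 0; 0, 1] = !![4, 0; 0, 1] * !![a, 0; 0, d] ∨
      (!![a, 0; 0, d] : Matrix (Fin 2) (Fin 2) (ZMod 5)) * !![4, 0; 0, 1] = !![1, 0; 0, 4] * !![a, 0; 0, d]) ∧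
    ((!![a, 0; 0, d] : Matrix (Fin 2) (Fin 2) (ZMod 5)) * !![1, 0; 0, 4] = !![4, 0; 0, 1] * !![a, 0; 0, d] ∨
      (!![a, 0; 0, d] : Matrix (Fin 2) (Fin 2) (ZMod 5)) * !![1, 0; 0, 4] = !![1, 0; 0, 4] * !![a, 0; 0, d]) := by
  decide

/-- Conjugating `diag(4,1)` / `diag(1,4)` by an antidiagonal element swaps them. [folklore] -/
private theorem a_conj_sq₅ : ∀ b c : ZMod 5,
    ((!![0, b; c, 0] : Matrix (Fin 2) (Fin 2) (ZMod 5)) * !![4, 0; 0, 1] = !![4, 0; 0, 1] * !![0, b; c, 0] ∨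
      (!![0, b; c, 0] : Matrix (Fin 2) (Fin 2) (ZMod 5)) * !![4, 0; 0, 1] = !![1, 0; 0, 4] * !![0, b; c, 0]) ∧
    ((!![0, b; c, 0] : Matrix (Fin 2) (Fin 2) (ZMod 5)) * !![1, 0; 0, 4] = !![4, 0; 0, 1] * !![0, b; c, 0] ∨
      (!![0, b; c, 0] : Matrix (Fin 2) (Fin 2) (ZMod 5)) * !![1, 0; 0, 4] = !![1, 0; 0, 4] * !![0, b; c, 0]) := by
  decide

/-- `V₀ = {diag(±1,±1)}` is normalised by `C_s⁺(5)` (on the generators `diag(4,1)`, `diag(1,4)`). [folklore] -/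
private theorem conj_sq_of_mem₅ {A : Matrix (Fin 2) (Fin 2) (ZMod 5)} (hA : A ∈ splitCartanNormalizer 5) :
    (A * !![4, 0; 0, 1] = !![4, 0; 0, 1] * A ∨ A * !![4, 0; 0, 1] = !![1, 0; 0, 4] * A) ∧
      (A * !![1, 0; 0, 4] = !![4, 0; 0, 1] * A ∨ A * !![1, 0; 0, 4] = !![1, 0; 0, 4] * A) := by
  rcases shape_of_mem_splitCartanNormalizer₅ hA with ⟨a, d, _, rfl⟩ | ⟨b, c, _, rfl⟩
  exacts [d_conj_sq₅ a d, a_conj_sq₅ b c]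

/-- The relations among `U = diag(2,1)`, `V = diag(1,2)`, `W = (0 1; 1 0)` used below. [folklore] -/
private theorem uvw_facts₅ :
    (!![2, 0; 0, 1] : Matrix (Fin 2) (Fin 2) (ZMod 5)) * !![1, 0; 0, 2] = !![1, 0; 0, 2] * !![2, 0; 0, 1] ∧
    (!![2, 0; 0, 1] : Matrix (Fin 2) (Fin 2) (ZMod 5)) * !![2, 0; 0, 1] * (!![2, 0; 0, 1] * !![2, 0; 0, 1]) = 1 ∧
    (!![1, 0; 0, 2] : Matrix (Fin 2) (Fin 2) (ZMod 5)) * !![1, 0; 0, 2] * (!![1, 0; 0, 2] * !![1, 0; 0, 2]) = 1 ∧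
    (!![0, 1; 1, 0] : Matrix (Fin 2) (Fin 2) (ZMod 5)) * !![0, 1; 1, 0] = 1 ∧
    (!![0, 1; 1, 0] : Matrix (Fin 2) (Fin 2) (ZMod 5)) * !![2, 0; 0, 1] * !![0, 1; 1, 0] = !![1, 0; 0, 2] ∧
    (!![0, 1; 1, 0] : Matrix (Fin 2) (Fin 2) (ZMod 5)) * !![1, 0; 0, 2] * !![0, 1; 1, 0] = !![2, 0; 0, 1] ∧
    (!![2, 0; 0, 1] : Matrix (Fin 2) (Fin 2) (ZMod 5)) * !![1, 0; 0, 2] = !![2, 0; 0, 2] ∧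
    (!![2, 0; 0, 1] : Matrix (Fin 2) (Fin 2) (ZMod 5)) * !![2, 0; 0, 1] = !![4, 0; 0, 1] ∧
    (!![1, 0; 0, 2] : Matrix (Fin 2) (Fin 2) (ZMod 5)) * !![1, 0; 0, 2] = !![1, 0; 0, 4] ∧
    (!![2, 0; 0, 1] : Matrix (Fin 2) (Fin 2) (ZMod 5)) * (!![1, 0; 0, 2] * !![1, 0; 0, 2] * !![1, 0; 0, 2]) =
      !![2, 0; 0, 3] := by
  decide

end Matrices

/-! ### §1 The bridge -/

/-- **`μ = 0` for the cyclotomic `ℤ_5`-tower of `L` from a faithful `C_s⁺(5)`-valued representation of `Gal(L/ℚ)` — NO named fact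
(Ferrero–Washington replaced by the three abelian leaves `K′`, `Z`, `Q₂`); fixed-field form.**  `L/ℚ` finite Galois; `ρ : Gal(L/ℚ) →* M₂(𝔽₅)` injective with every `ρ(g)` in
`splitCartanNormalizer 5`; `u, v, w ∈ Gal(L/ℚ)` with `ρ u = diag(2,1)`, `ρ v = diag(1,2)`, `ρ w = (0 1; 1 0)` (for `L = ℚ(E[5])` with
image all of `C_s⁺(5)` in the basis `(P₁, P₂)`: `L^{⟨v⟩} = ℚ(P₁)`, `L^{⟨u², v⟩} = ℚ(x P₁)`, `L^{⟨uv, w⟩} = ℚ(⟨P₁ + P₂⟩)`).  If `μ = 0`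
holds for every cyclotomic `ℤ_5`-extension of `L^{⟨v⟩}`, `L^{⟨u²v⟩}`, `L^{⟨uv⟩ ⊔ ⟨w⟩}` and of the three ABELIAN fields `L^{⟨uv⁻¹⟩ ⊔ ⟨w⟩}`
(`K′`), `L^{⟨uv⁻¹⟩ ⊔ ⟨u²w⟩}` (`Z = ℚ(ζ₅)`), `L^{⟨uv⁻¹⟩ ⊔ ⟨wu⟩}` (`Q₂`), then for every cyclotomic `ℤ_5`-extension of `L` — NO named fact.  All
relations of `classicalMuVanishes_of_isCyclotomic_of_splitCartan_kuroda_rat_abelian` are read off the 32 matrices of `C_s⁺(5)` by `decide`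
(commutators in `⟨diag(2,3)⟩ = ρ⟨u v⁻¹⟩`, `diag(2,2) = ρ(uv)` central, `⟨diag(4,1), diag(1,4)⟩ = ρ⟨u², v²⟩` normal, `g⁸ = 1` so
`5 ∤ [L:ℚ]`). [cite: Serre1972, §2.2 (split Cartan subgroups, normalisers)]
[cite: Lemmermeyer1994, §1 (Kuroda's class number formula, odd part)] [cite: Washington1997, §7.5, §13.1] -/
theorem classicalMuVanishes_of_isCyclotomic_of_splitCartanNormalizer_five_fixedField_abelian
    [Fact (Nat.Prime 5)] (L : Type) [Field L] [NumberField L] [IsGalois ℚ L]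
    (ρ : (L ≃ₐ[ℚ] L) →* Matrix (Fin 2) (Fin 2) (ZMod 5)) (hρ : Function.Injective ρ)
    (himg : ∀ g, ρ g ∈ splitCartanNormalizer 5) {u v w : L ≃ₐ[ℚ] L} (hu : ρ u = !![2, 0; 0, 1])
    (hv : ρ v = !![1, 0; 0, 2]) (hw : ρ w = !![0, 1; 1, 0])
    (hμP : ∀ κE : ZpExtension ↥(fixedField (Subgroup.zpowers v)) 5, κE.IsCyclotomic → ClassicalMuVanishes κE)
    (hμD : ∀ κE : ZpExtension ↥(fixedField (Subgroup.zpowers (u * u * v))) 5, κE.IsCyclotomic → ClassicalMuVanishes κE)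
    (hμC : ∀ κE : ZpExtension ↥(fixedField (Subgroup.zpowers (u * v) ⊔ Subgroup.zpowers w)) 5,
      κE.IsCyclotomic → ClassicalMuVanishes κE)
    (hμK : ∀ κE : ZpExtension ↥(fixedField (Subgroup.zpowers (u * v⁻¹) ⊔ Subgroup.zpowers w)) 5,
      κE.IsCyclotomic → ClassicalMuVanishes κE)
    (hμZ : ∀ κE : ZpExtension ↥(fixedField (Subgroup.zpowers (u * v⁻¹) ⊔ Subgroup.zpowers (u * u * w))) 5,
      κE.IsCyclotomic → ClassicalMuVanishes κE)
    (hμQ : ∀ κE : ZpExtension ↥(fixedField (Subgroup.zpowers (u * v⁻¹) ⊔ Subgroup.zpowers (w * u))) 5,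
      κE.IsCyclotomic → ClassicalMuVanishes κE)
    (κL : ZpExtension L 5) (hκL : κL.IsCyclotomic) : ClassicalMuVanishes κL := by
  obtain ⟨fUV, fU4, fV4, fW2, fWUW, fWVW, fUVs, fUU, fVV, fD⟩ := uvw_facts₅
  -- relations among `u, v, w`
  have huv : u * v = v * u := hρ (by rw [map_mul, map_mul, hu, hv, fUV])
  have hu4 : u * u * (u * u) = 1 := hρ (by simp only [map_mul, map_one, hu]; exact fU4)
  have hv4 : v * v * (v * v) = 1 := hρ (by simp only [map_mul, map_one, hv]; exact fV4)
  have hw2 : w * w = 1 := hρ (by rw [map_mul, hw, fW2, map_one])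
  have hwinv : w⁻¹ = w := inv_eq_of_mul_eq_one_right hw2
  have hwu : w * u * w⁻¹ = v := by rw [hwinv]; exact hρ (by rw [map_mul, map_mul, hw, hu, fWUW, hv])
  have hwv : w * v * w⁻¹ = u := by rw [hwinv]; exact hρ (by rw [map_mul, map_mul, hw, hv, fWVW, hu])
  have hρuv : ρ (u * v) = !![2, 0; 0, 2] := by rw [map_mul, hu, hv, fUVs]
  have hρuu : ρ (u * u) = !![4, 0; 0, 1] := by rw [map_mul, hu, fUU]
  have hρvv : ρ (v * v) = !![1, 0; 0, 4] := by rw [map_mul, hv, fVV]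
  have hvinv : v⁻¹ = v * v * v := inv_eq_of_mul_eq_one_right (by rw [← hv4]; group)
  have hρD : ρ (u * v⁻¹) = !![2, 0; 0, 3] := by rw [hvinv]; simp only [map_mul, hu, hv]; exact fD
  -- `uv` central
  have hsc : ∀ g : L ≃ₐ[ℚ] L, g * (u * v) = (u * v) * g := fun g =>
    hρ (by rw [map_mul ρ g (u * v), map_mul ρ (u * v) g, hρuv]; exact scalar_comm_of_mem₅ (himg g))
  -- `⟨u², v²⟩` normal
  have hVu : ∀ g : L ≃ₐ[ℚ] L, g * (u * u) * g⁻¹ = u * u ∨ g * (u * u) * g⁻¹ = v * v := by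
    intro g
    rcases (conj_sq_of_mem₅ (himg g)).1 with h | h
    · left
      rw [mul_inv_eq_iff_eq_mul]
      exact hρ (by rw [map_mul ρ g (u * u), map_mul ρ (u * u) g, hρuu]; exact h)
    · right
      rw [mul_inv_eq_iff_eq_mul]
      exact hρ (by rw [map_mul ρ g (u * u), map_mul ρ (v * v) g, hρuu, hρvv]; exact h)
  have hVv : ∀ g : L ≃ₐ[ℚ] L, g * (v * v) * g⁻¹ = u * u ∨ g * (v * v) * g⁻¹ = v * v := by
    intro g
    rcases (conj_sq_of_mem₅ (himg g)).2 with h | h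
    · left
      rw [mul_inv_eq_iff_eq_mul]
      exact hρ (by rw [map_mul ρ g (v * v), map_mul ρ (u * u) g, hρuu, hρvv]; exact h)
    · right
      rw [mul_inv_eq_iff_eq_mul]
      exact hρ (by rw [map_mul ρ g (v * v), map_mul ρ (v * v) g, hρvv]; exact h)
  -- commutators in `⟨u v⁻¹⟩`
  have hcomm : ∀ a c : L ≃ₐ[ℚ] L, a * c * a⁻¹ * c⁻¹ ∈ Subgroup.zpowers (u * v⁻¹) := by
    intro a c
    have key : ∀ x : L ≃ₐ[ℚ] L, a * c = x * (c * a) → a * c * a⁻¹ * c⁻¹ = x := fun x hx => by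
      rw [show a * c * a⁻¹ * c⁻¹ = (a * c) * (c * a)⁻¹ by group, hx]; group
    rcases mul_eq_of_mem₅ (himg a) (himg c) with h | h | h | h
    · rw [key 1 (by rw [one_mul]; exact hρ (by rw [map_mul ρ a c, map_mul ρ c a]; exact h))]
      exact Subgroup.one_mem _
    · rw [key (u * v⁻¹) (hρ (by rw [map_mul ρ a c, map_mul ρ (u * v⁻¹) (c * a), map_mul ρ c a, hρD]; exact h))]
      exact Subgroup.mem_zpowers _
    · rw [key (u * v⁻¹ * (u * v⁻¹)) (hρ (by
        rw [map_mul ρ a c, map_mul ρ (u * v⁻¹ * (u * v⁻¹)) (c * a), map_mul ρ (u * v⁻¹) (u * v⁻¹), map_mul ρ c a, hρD]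
        exact h))]
      exact (Subgroup.zpowers _).mul_mem (Subgroup.mem_zpowers _) (Subgroup.mem_zpowers _)
    · rw [key (u * v⁻¹ * (u * v⁻¹) * (u * v⁻¹)) (hρ (by
        rw [map_mul ρ a c, map_mul ρ (u * v⁻¹ * (u * v⁻¹) * (u * v⁻¹)) (c * a), map_mul ρ (u * v⁻¹ * (u * v⁻¹)) (u * v⁻¹),
          map_mul ρ (u * v⁻¹) (u * v⁻¹), map_mul ρ c a, hρD]
        exact h))]
      exact (Subgroup.zpowers _).mul_mem ((Subgroup.zpowers _).mul_mem (Subgroup.mem_zpowers _)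
        (Subgroup.mem_zpowers _)) (Subgroup.mem_zpowers _)
  -- `Gal(L/ℚ)` is a `2`-group, so `5 ∤ [L : ℚ]`
  have hp : ¬ 5 ∣ Module.finrank ℚ L := by
    haveI : Fact (Nat.Prime 2) := ⟨Nat.prime_two⟩
    have h2 : IsPGroup 2 (L ≃ₐ[ℚ] L) := fun g => ⟨3, hρ (by rw [map_pow, map_one]; exact pow_eight_eq_one_of_mem₅ (himg g))⟩
    obtain ⟨n, hn⟩ := IsPGroup.iff_card.mp h2
    rw [← IsGalois.card_aut_eq_finrank, hn]
    intro h
    have h5 : (5 : ℕ) ∣ 2 := (Nat.prime_five).dvd_of_dvd_pow h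
    omega
  exact classicalMuVanishes_of_isCyclotomic_of_splitCartan_kuroda_rat_abelian (by decide) L hp huv hu4 hv4 hw2 hwu hwv hsc hVu hVv
    hcomm hμP hμD hμC hμK hμZ hμQ κL hκL

/-! ### §2 The basis form on `ℚ(E[5])` -/

section DivisionField

open scoped Matrix

open WeierstrassCurve Literature.NumberTheory.GaloisRepresentations

/-- `Γ_ℚ → Gal(ℚ(E[n])/ℚ)` is onto. [folklore] -/
private theorem absRestrictNormalHom_surjective_dF₆ {F : Type*} [Field F] (E : IntermediateField F (AlgebraicClosure F))
    [Normal F E] : Function.Surjective (absRestrictNormalHom E) := fun g => by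
  obtain ⟨σ, hσ⟩ := AlgEquiv.restrictNormalHom_surjective (AlgebraicClosure F) g
  exact ⟨(absoluteGaloisGroup.toAlgEquiv F).symm σ, hσ⟩

/-- Two matrices with the same action on the vectors `e P` are equal. [folklore] -/
private theorem matrix_eq_of_forall_mulVec₆ {A : Type*} [AddCommGroup A] {n : ℕ} (e : A ≃+ (Fin 2 → ZMod n))
    {M N : Matrix (Fin 2) (Fin 2) (ZMod n)} (h : ∀ P : A, M *ᵥ e P = N *ᵥ e P) : M = N :=
  Matrix.toLin'.injective (LinearMap.ext fun v => by
    rw [Matrix.toLin'_apply, Matrix.toLin'_apply, ← e.apply_symm_apply v, h])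

/-- `…_splitCartanNormalizer_five_fixedField_abelian` for any `ℚ`-algebra structure on `L` (all coincide: `Subsingleton (Algebra ℚ L)`).
[cite: Serre1972, §2.2 (split Cartan subgroups, normalisers)] [cite: Washington1997, §7.5, §13.1] -/
private theorem split_five_fixedField_alg_abelian [Fact (Nat.Prime 5)]
    (L : Type) [Field L] [NumberField L] [alg : Algebra ℚ L] [IsGalois ℚ L]
    (ρ : (L ≃ₐ[ℚ] L) →* Matrix (Fin 2) (Fin 2) (ZMod 5)) (hρ : Function.Injective ρ)
    (himg : ∀ g, ρ g ∈ splitCartanNormalizer 5) {u v w : L ≃ₐ[ℚ] L} (hu : ρ u = !![2, 0; 0, 1])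
    (hv : ρ v = !![1, 0; 0, 2]) (hw : ρ w = !![0, 1; 1, 0])
    (hμP : ∀ κE : ZpExtension ↥(fixedField (Subgroup.zpowers v)) 5, κE.IsCyclotomic → ClassicalMuVanishes κE)
    (hμD : ∀ κE : ZpExtension ↥(fixedField (Subgroup.zpowers (u * u * v))) 5, κE.IsCyclotomic → ClassicalMuVanishes κE)
    (hμC : ∀ κE : ZpExtension ↥(fixedField (Subgroup.zpowers (u * v) ⊔ Subgroup.zpowers w)) 5,
      κE.IsCyclotomic → ClassicalMuVanishes κE)
    (hμK : ∀ κE : ZpExtension ↥(fixedField (Subgroup.zpowers (u * v⁻¹) ⊔ Subgroup.zpowers w)) 5,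
      κE.IsCyclotomic → ClassicalMuVanishes κE)
    (hμZ : ∀ κE : ZpExtension ↥(fixedField (Subgroup.zpowers (u * v⁻¹) ⊔ Subgroup.zpowers (u * u * w))) 5,
      κE.IsCyclotomic → ClassicalMuVanishes κE)
    (hμQ : ∀ κE : ZpExtension ↥(fixedField (Subgroup.zpowers (u * v⁻¹) ⊔ Subgroup.zpowers (w * u))) 5,
      κE.IsCyclotomic → ClassicalMuVanishes κE)
    (κL : ZpExtension L 5) (hκL : κL.IsCyclotomic) : ClassicalMuVanishes κL := by
  have h : alg = DivisionRing.toRatAlgebra := Subsingleton.elim _ _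
  subst h
  exact classicalMuVanishes_of_isCyclotomic_of_splitCartanNormalizer_five_fixedField_abelian L ρ hρ himg hu hv hw hμP hμD hμC hμK
    hμZ hμQ κL hκL

/-- **`μ = 0` for `ℚ(E[5])_cyc` from a split-Cartan-normaliser mod-5 image — NO named fact (Ferrero–Washington replaced by the
three abelian leaves).**  `E/ℚ` elliptic;
`e` a basis of `E[5]` in which every `σ ∈ Γ_ℚ` acts through `splitCartanNormalizer 5` (so `HasSplitCartanNormalizerModPImage E 5`);
`σ_u, σ_v, σ_w ∈ Γ_ℚ` acting in the basis `e` as `diag(2,1)`, `diag(1,2)`, `(0 1; 1 0)` (they exist when the image is all of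
`C_s⁺(5)`).  If `μ = 0` holds for every cyclotomic `ℤ_5`-extension of the fixed fields in `ℚ(E[5])` of `⟨σ̄_v⟩` (`= ℚ(P₁)`, 8),
`⟨σ̄_u² σ̄_v⟩` (8), `⟨σ̄_u σ̄_v⟩ ⊔ ⟨σ̄_w⟩` (`= ℚ(⟨P₁+P₂⟩)`, 4), `⟨σ̄_u σ̄_v⁻¹⟩ ⊔ ⟨σ̄_w⟩` (`K′`: cyclic quartic `⊇ ℚ(√5)`),
`⟨σ̄_u σ̄_v⁻¹⟩ ⊔ ⟨σ̄_u² σ̄_w⟩` (`= ℚ(ζ₅)`, the kernel of `det`) and `⟨σ̄_u σ̄_v⁻¹⟩ ⊔ ⟨σ̄_w σ̄_u⟩` (`Q₂ = ℚ(√(5d₁))`, `d₁ = disc` of the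
quadratic field `ℚ(E[5])^{C_s(5)}` over which the two `5`-isogenies are defined), then for every cyclotomic `ℤ_5`-extension of
`ℚ(E[5])`: the hypothesis of road (b) (`CoatesSujatha2005.thm34_…_holds`) at `p = 5`.  No growth theorem, no named fact; Kuroda equalities
only.
[cite: Serre1972, §2.2 (split Cartan subgroups, normalisers)] [cite: Lemmermeyer1994, §1 (Kuroda's class number formula, odd part)]
[cite: Washington1997, §7.5, §13.1] -/
theorem classicalMuVanishes_divisionField_of_splitCartanBasis_five_abelian
    [Fact (Nat.Prime 5)] (W : WeierstrassCurve ℚ) [W.IsElliptic] (e : W.geomTorsion (5 : ℕ) ≃+ (Fin 2 → ZMod 5))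
    (he : ∀ σ : absoluteGaloisGroup ℚ, ∃ M ∈ splitCartanNormalizer 5, ∀ P : W.geomTorsion (5 : ℕ), e (σ • P) = M *ᵥ e P)
    (σu σv σw : absoluteGaloisGroup ℚ) (hσu : ∀ P : W.geomTorsion (5 : ℕ), e (σu • P) = !![2, 0; 0, 1] *ᵥ e P)
    (hσv : ∀ P : W.geomTorsion (5 : ℕ), e (σv • P) = !![1, 0; 0, 2] *ᵥ e P)
    (hσw : ∀ P : W.geomTorsion (5 : ℕ), e (σw • P) = !![0, 1; 1, 0] *ᵥ e P)
    (hμP : haveI : NumberField ↥(W.divisionField 5) := NumberField.mk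
      ∀ κE : ZpExtension ↥(fixedField (Subgroup.zpowers (absRestrictNormalHom (W.divisionField 5) σv))) 5,
        κE.IsCyclotomic → ClassicalMuVanishes κE)
    (hμD : haveI : NumberField ↥(W.divisionField 5) := NumberField.mk
      ∀ κE : ZpExtension ↥(fixedField (Subgroup.zpowers (absRestrictNormalHom (W.divisionField 5) σu *
        absRestrictNormalHom (W.divisionField 5) σu * absRestrictNormalHom (W.divisionField 5) σv))) 5,
        κE.IsCyclotomic → ClassicalMuVanishes κE)
    (hμC : haveI : NumberField ↥(W.divisionField 5) := NumberField.mk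
      ∀ κE : ZpExtension ↥(fixedField (Subgroup.zpowers (absRestrictNormalHom (W.divisionField 5) σu *
        absRestrictNormalHom (W.divisionField 5) σv) ⊔ Subgroup.zpowers (absRestrictNormalHom (W.divisionField 5) σw))) 5,
        κE.IsCyclotomic → ClassicalMuVanishes κE)
    (hμK : haveI : NumberField ↥(W.divisionField 5) := NumberField.mk
      ∀ κE : ZpExtension ↥(fixedField (Subgroup.zpowers (absRestrictNormalHom (W.divisionField 5) σu *
        (absRestrictNormalHom (W.divisionField 5) σv)⁻¹) ⊔ Subgroup.zpowers (absRestrictNormalHom (W.divisionField 5) σw))) 5,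
        κE.IsCyclotomic → ClassicalMuVanishes κE)
    (hμZ : haveI : NumberField ↥(W.divisionField 5) := NumberField.mk
      ∀ κE : ZpExtension ↥(fixedField (Subgroup.zpowers (absRestrictNormalHom (W.divisionField 5) σu *
        (absRestrictNormalHom (W.divisionField 5) σv)⁻¹) ⊔ Subgroup.zpowers (absRestrictNormalHom (W.divisionField 5) σu *
        absRestrictNormalHom (W.divisionField 5) σu * absRestrictNormalHom (W.divisionField 5) σw))) 5,
        κE.IsCyclotomic → ClassicalMuVanishes κE)
    (hμQ : haveI : NumberField ↥(W.divisionField 5) := NumberField.mk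
      ∀ κE : ZpExtension ↥(fixedField (Subgroup.zpowers (absRestrictNormalHom (W.divisionField 5) σu *
        (absRestrictNormalHom (W.divisionField 5) σv)⁻¹) ⊔ Subgroup.zpowers (absRestrictNormalHom (W.divisionField 5) σw *
        absRestrictNormalHom (W.divisionField 5) σu))) 5,
        κE.IsCyclotomic → ClassicalMuVanishes κE) :
    haveI : NumberField ↥(W.divisionField 5) := NumberField.mk
    ∀ κL : ZpExtension ↥(W.divisionField 5) 5, κL.IsCyclotomic → ClassicalMuVanishes κL := by
  haveI : NumberField ↥(W.divisionField 5) := NumberField.mk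
  intro κL hκL
  obtain ⟨ρ, hρ, hρe⟩ := exists_matrixRep_divisionField W 5 e
  have hπ := absRestrictNormalHom_surjective_dF₆ (W.divisionField 5)
  have hmat : ∀ (σ : absoluteGaloisGroup ℚ) (M : Matrix (Fin 2) (Fin 2) (ZMod 5)),
      (∀ P : W.geomTorsion (5 : ℕ), e (σ • P) = M *ᵥ e P) → ρ (absRestrictNormalHom (W.divisionField 5) σ) = M :=
    fun σ M hM => matrix_eq_of_forall_mulVec₆ e fun P => by rw [← hρe, hM]
  have himg' : ∀ g, ρ g ∈ splitCartanNormalizer 5 := fun g => by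
    obtain ⟨σ, rfl⟩ := hπ g
    obtain ⟨M, hM, hMe⟩ := he σ
    rw [hmat σ M hMe]
    exact hM
  exact @split_five_fixedField_alg_abelian _ ↥(W.divisionField 5) _ _ (_) (W.isGalois_divisionField 5) ρ hρ himg' _ _ _
    (hmat σu _ hσu) (hmat σv _ hσv) (hmat σw _ hσw) hμP hμD hμC hμK hμZ hμQ κL hκL

end DivisionField

end Literature.NumberTheory.IwasawaTheory

end
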